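import Summits.HodgeConjecture.HodgeConjecture.Theorems.K2LiuInertFrameInputs
import Literature.NumberTheory.GelbartRogawski1991.LocalUnitaryIntegralLattice
import Literature.NumberTheory.Automorphic.UnitaryGroupSplitPlace                  -- ★ `mem_glInt_adicCompletion_iff`

/-!
# The frame inputs of ★ (C3′) along the Hecke transversal at an inert unramified place, WITH INTEGRALITY of the frame vectors
# (LOCAL SEAM of s23, inert package, organ (L24-b) (F2′))

Track B ∕ K2-LIT, hLiu418 = stmt-HodgeConjecture-24832; LEAD F0P6-plan (g11) «M-155g» (ii) ∕ «M-155i» ((L24-b) by ROAD A′).  Helper (count-neutral, own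
head per LEAD R3).  THEOREMS ONLY (no `def`, no instance, no notation, no named fact, no `sorry`).  Sequel of ★ (F2) `K2LiuInertFrameInputs` (same frame
`y_w = T⁻¹e₀ ⊗ 1`, `y*_w = a⁻¹·T⁻¹e₁ ⊗ 1`, same transversal, same conclusions) with TWO MORE clauses: `y` and `y*` are integral over
`S = Π_{w'∣v} L_{w'}` (★ `IsIntegralLoc`), granted `T ∈ GL₂(𝒪_w)` (`hTi`) and `a` a unit at `w` (`ha`) — exactly the hypotheses `hy hys` of ★ (Λ-c)
`K2LiuIntegralSwap.localSwapElt_swapVector_mem_localInt` (`w₀ ∈ H(𝒪_v)`), so that ★ (Λ-b)'s non-vanishing applies to ★ (C3′)'s swap of THIS frame.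
[GelbartRogawski1991, §3.2 (3.2.2) p. 457]; [Kudla1994, §2–§3 Thm. 3.1]; [PlatonovRapinchuk1994, §5.1]; [BruhatTits1972, (4.4.4)].
HONEST LABEL: HC_CM is proved only modulo the printed citations (2 remaining named inputs: hLiu418 = stmt-HodgeConjecture-24832, h413 =
stmt-HodgeConjecture-24833) until rung 0 closes; this file is unconditional and moves no counter.
-/

set_option autoImplicit false

set_option linter.dupNamespace false

noncomputable section

open scoped Matrix Kronecker Pointwise Valued
open NumberField IsDedekindDomain Matrix MulAction

namespace Summit.HodgeConjecture.HodgeConjecture.Cruxes.HLiu418.K2LiuInertFrameInputsIntegral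

open Literature.NumberTheory.Automorphic Literature.NumberTheory.Automorphic.UnitaryGroup Literature.NumberTheory.Automorphic.HermitianLattice
open Literature.NumberTheory.Automorphic.Liu2021 Literature.NumberTheory.Automorphic.Liu2021.Def411WeilCarriers
open Literature.NumberTheory.GelbartRogawski1991 Literature.NumberTheory.GelbartRogawski1991.GRConstruction
open Literature.NumberTheory.GelbartRogawski1991.UnitaryDualPair Literature.NumberTheory.GelbartRogawski1991.UnitaryDualPair.LocalSplitting
open Literature.NumberTheory.GaloisRepresentations
open Summit.HodgeConjecture.HodgeConjecture.Cruxes.HLiu418.K2LiuHyperbolicFrameVectors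
open Summit.HodgeConjecture.HodgeConjecture.Cruxes.HLiu418.K2LiuInertHeckeTransversalBorel
open Summit.HodgeConjecture.HodgeConjecture.Cruxes.HLiu418.K2LiuInertFrameInputs

section Inert

variable (L : Type) [Field L] [NumberField L] [IsCMField L]
variable (dV : Fin 2 → L) (v : HeightOneSpectrum (𝓞 (Fp L)))

set_option maxHeartbeats 800000 in -- measured 2026-09-04 (as ★ (T) `exists_heckeTransversal_borel_inert`): the adelic unitary datum (`localPi`, `localInt`, quotient, orbits)
/-- **THE FRAME INPUTS OF ★ (C3′) ALONG THE HECKE TRANSVERSAL, WITH INTEGRALITY** (organ (L24-b) (F2′); ★ (F2) `exists_frameInputs_inert` plus: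
`y`, `y*` have INTEGRAL coordinates over `S = Π_{w'∣v} L_{w'}` (★ `IsIntegralLoc`) when `a` is a unit at `w` — the hypotheses `hy hys` of ★ (Λ-c)): the transversal
`X₊ ∪ X₀ ∪ {t₁⁻¹}` of `K_v t₁ K_v ∕ K_v` of ★ (T) (`|X₊| = q_v²`, `|X₀| = q_v − 1`), a hyperbolic frame `(y, y*)` of `S^{n′} = (V ⊗ W) ⊗ L⁺_v` for
`h = hermForm σ_S (gramS (gram e₁ diag(dV) (a)))` — `h(y,y) = 0`, `h(y*,y) = h(y,y*) = 1`, `y^⊥ = S·y` — and scalars `α₊`, `α₋` with `(α₊)_w = ϖ`,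
`(α₋)_w = ϖ⁻¹`, such that `(x ⊗ 1_W)·y = α₊·y` (`x ∈ X₊`), `= 1·y` (`x ∈ X₀`), `= α₋·y` (`x = t₁⁻¹`) in ★ `localPiEquiv ∘ localLineInl` coordinates.
[cite: GelbartRogawski1991, §3.2 (3.2.2) p. 457] [cite: Kudla1994, §2–§3 Thm. 3.1] [cite: MoeglinVignerasWaldspurger1987, Chap. 1 I.17] [cite: BruhatTits1972, (4.4.4)] -/
theorem exists_frameInputs_integral_inert [DecidableEq (UnitaryGroup.localPi L (IsCMField.complexConj L) 2 (Matrix.diagonal dV) v)]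
    (hdV : ∀ i, IsCMField.complexConj L (dV i) = dV i) {n' : ℕ} (e₁ : Fin 2 × Fin 1 ≃ Fin n') (a : (Fp L)ˣ)
    (w : UnitaryGroup.PlacesOver L v) (hw : IsCMField.complexConj L • w.1 = w.1)
    (hv : Algebra.IsUnramifiedIn (𝓞 L) v.asIdeal)
    {ϖ : w.1.adicCompletion L} (hϖ : Valued.v ϖ = WithZero.exp (-1 : ℤ))
    (hϖσ : galAdicCompletionMap (L := L) (IsCMField.complexConj L) hw ϖ = ϖ)
    (T : GL (Fin 2) (w.1.adicCompletion L)) (hTi : T ∈ glInt 2 (w.1.adicCompletion L))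
    (hTJ : UnitaryGroup.placeForm (Matrix.diagonal dV) w.1 =
      formCongr (galAdicCompletionMap (L := L) (IsCMField.complexConj L) hw) T ((StdForm.antidiagonal 2).over (w.1.adicCompletion L)))
    (t₁ : UnitaryGroup.localPi L (IsCMField.complexConj L) 2 (Matrix.diagonal dV) v)
    (ht₁ : Units.val ((t₁ : UnitaryGroup.LocalGLPi L 2 v) w) =
      ((T⁻¹ : GL (Fin 2) (w.1.adicCompletion L)) : Matrix (Fin 2) (Fin 2) (w.1.adicCompletion L)) *
        Matrix.diagonal ![ϖ, ϖ⁻¹] * (T : Matrix (Fin 2) (Fin 2) (w.1.adicCompletion L)))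
    (ha : Valued.v ((algebraMap (Fp L) L (a : Fp L) : L) : w.1.adicCompletion L) = 1) :
    ∃ Xp X0 : Finset (UnitaryGroup.localPi L (IsCMField.complexConj L) 2 (Matrix.diagonal dV) v),
      Set.BijOn (fun x : UnitaryGroup.localPi L (IsCMField.complexConj L) 2 (Matrix.diagonal dV) v =>
          (x : UnitaryGroup.localPi L (IsCMField.complexConj L) 2 (Matrix.diagonal dV) v ⧸
            UnitaryGroup.localInt L (IsCMField.complexConj L) 2 (Matrix.diagonal dV) v))
        (Xp ∪ X0 ∪ {t₁⁻¹} : Finset _)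
        (orbit (UnitaryGroup.localInt L (IsCMField.complexConj L) 2 (Matrix.diagonal dV) v)
          (t₁ : UnitaryGroup.localPi L (IsCMField.complexConj L) 2 (Matrix.diagonal dV) v ⧸
            UnitaryGroup.localInt L (IsCMField.complexConj L) 2 (Matrix.diagonal dV) v)) ∧
      Xp.card = v.residueCard ^ 2 ∧ X0.card = v.residueCard - 1 ∧
      ∃ (y ys : Fin n' → UnitaryGroup.LocalRing L v) (αp αm : UnitaryGroup.LocalRing L v),
        hermForm (conjLocal L (IsCMField.complexConj L) v)
            (gramS (Fp L) L v n' (gram (Fp L) e₁ (realDiagonal L dV hdV) (TW (Fp L) a))) y y = 0 ∧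
        hermForm (conjLocal L (IsCMField.complexConj L) v)
            (gramS (Fp L) L v n' (gram (Fp L) e₁ (realDiagonal L dV hdV) (TW (Fp L) a))) ys y = 1 ∧
        hermForm (conjLocal L (IsCMField.complexConj L) v)
            (gramS (Fp L) L v n' (gram (Fp L) e₁ (realDiagonal L dV hdV) (TW (Fp L) a))) y ys = 1 ∧
        (∀ b : Fin n' → UnitaryGroup.LocalRing L v,
          hermForm (conjLocal L (IsCMField.complexConj L) v)
              (gramS (Fp L) L v n' (gram (Fp L) e₁ (realDiagonal L dV hdV) (TW (Fp L) a))) y b = 0 →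
            ∃ s : UnitaryGroup.LocalRing L v, b = s • y) ∧
        (∀ b : Fin n', IsIntegralLoc (Fp L) L v (y b)) ∧ (∀ b : Fin n', IsIntegralLoc (Fp L) L v (ys b)) ∧
        αp w = ϖ ∧ αm w = ϖ⁻¹ ∧
        (∀ x ∈ Xp,
          (((localPiEquiv L (IsCMField.complexConj L) n' (Matrix.reindex e₁ e₁ (Matrix.diagonal dV ⊗ₖ JW (Fp L) L a)) v
              (localLineInl L (IsCMField.complexConj L) 2 e₁ (Matrix.diagonal dV) (JW (Fp L) L a) v x)).1 :
              GL (Fin n') (UnitaryGroup.LocalRing L v)).1) *ᵥ y = αp • y) ∧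
        (∀ x ∈ X0,
          (((localPiEquiv L (IsCMField.complexConj L) n' (Matrix.reindex e₁ e₁ (Matrix.diagonal dV ⊗ₖ JW (Fp L) L a)) v
              (localLineInl L (IsCMField.complexConj L) 2 e₁ (Matrix.diagonal dV) (JW (Fp L) L a) v x)).1 :
              GL (Fin n') (UnitaryGroup.LocalRing L v)).1) *ᵥ y = (1 : UnitaryGroup.LocalRing L v) • y) ∧
        (((localPiEquiv L (IsCMField.complexConj L) n' (Matrix.reindex e₁ e₁ (Matrix.diagonal dV ⊗ₖ JW (Fp L) L a)) v
            (localLineInl L (IsCMField.complexConj L) 2 e₁ (Matrix.diagonal dV) (JW (Fp L) L a) v t₁⁻¹)).1 :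
            GL (Fin n') (UnitaryGroup.LocalRing L v)).1) *ᵥ y = αm • y := by
  classical
  haveI : Algebra.IsQuadraticExtension (Fp L) L := IsCMField.isQuadraticExtension L
  have hc : IsCMField.complexConj L ≠ 1 := IsCMField.complexConj_ne_one L
  -- ★ (T): the transversal and the frame eigen-relations at `w`
  obtain ⟨Xp, X0, hX, hcp, hc0, hXp, hX0, hti⟩ := heckeTransversal_mulVec_frameVec_inert L dV v w hw hv hϖ hϖσ T hTi hTJ t₁ ht₁
  set σ : w.1.adicCompletion L →+* w.1.adicCompletion L := galAdicCompletionMap (L := L) (IsCMField.complexConj L) hw with hσ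
  set y₀ : Fin 2 → w.1.adicCompletion L :=
    ((T⁻¹ : GL (Fin 2) (w.1.adicCompletion L)) : Matrix (Fin 2) (Fin 2) (w.1.adicCompletion L)) *ᵥ Pi.single 0 1 with hy₀
  set y₁ : Fin 2 → w.1.adicCompletion L :=
    ((T⁻¹ : GL (Fin 2) (w.1.adicCompletion L)) : Matrix (Fin 2) (Fin 2) (w.1.adicCompletion L)) *ᵥ Pi.single 1 1 with hy₁
  -- the `W`-unit `a` read in `L_w`: non-zero and `σ_w`-fixed
  set aw : w.1.adicCompletion L := ((algebraMap (Fp L) L (a : Fp L) : L) : w.1.adicCompletion L) with haw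
  have haL : (algebraMap (Fp L) L (a : Fp L) : L) ≠ 0 := (map_ne_zero _).2 a.ne_zero
  have haw0 : aw ≠ 0 := by
    have h := (map_ne_zero (algebraMap L (w.1.adicCompletion L))).2 haL
    simpa only [HeightOneSpectrum.algebraMap_adicCompletion, Function.comp_apply, Algebra.algebraMap_self, RingHom.id_apply] using h
  have hσa : σ aw = aw := by rw [hσ, haw, galAdicCompletionMap_algebraMap]
  -- the lift `z ↦ z ⊗ 1_W` of a `w`-vector to `S^{n'}` and equality through the `w`-component
  let up : (Fin 2 → w.1.adicCompletion L) → (Fin n' → UnitaryGroup.LocalRing L v) := fun z b =>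
    Pi.single (M := fun w' : UnitaryGroup.PlacesOver L v => w'.1.adicCompletion L) w (z (e₁.symm b).1)
  have hup : ∀ z b, up z b w = z (e₁.symm b).1 := fun z b =>
    Pi.single_eq_same (M := fun w' : UnitaryGroup.PlacesOver L v => w'.1.adicCompletion L) w _
  have hupw : ∀ z, (fun b => up z b w) = fun b => z (e₁.symm b).1 := fun z => funext (hup z)
  have hveq : ∀ Y Y' : Fin n' → UnitaryGroup.LocalRing L v, (∀ b, Y b w = Y' b w) → Y = Y' := fun Y Y' h =>
    funext fun b => (LocalRing.eq_iff_apply_eq (IsCMField.complexConj L) hc w hw _ _).2 (h b)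
  -- the Gram matrix read at `w`: `reindex e₁ (diag(dV)_w ⊗ (a)) = reindex e₁ ((σT)ᵀ antidiag T ⊗ (a))`
  have hW1 : UnitaryGroup.placeForm (JW (Fp L) L a) w.1 = Matrix.of fun _ _ : Fin 1 => aw := by
    refine Matrix.ext fun i j => ?_
    fin_cases i; fin_cases j
    simp only [UnitaryGroup.placeForm, JW_eq, TW, Matrix.map_apply, Matrix.of_apply, Matrix.cons_val', Matrix.cons_val_fin_one,
      Matrix.empty_val', HeightOneSpectrum.algebraMap_adicCompletion, Function.comp_apply, Algebra.algebraMap_self, RingHom.id_apply, haw]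
  have hG : (gramS (Fp L) L v n' (gram (Fp L) e₁ (realDiagonal L dV hdV) (TW (Fp L) a))).map
      (Pi.evalRingHom (fun w' : UnitaryGroup.PlacesOver L v => w'.1.adicCompletion L) w) =
      Matrix.reindex e₁ e₁ (formCongr σ T ((StdForm.antidiagonal 2).over (w.1.adicCompletion L)) ⊗ₖ (Matrix.of fun _ _ : Fin 1 => aw)) := by
    rw [gramS_map_evalRingHom, ← reindex_kronecker_eq_gram_map (Fp L) L e₁ (realDiagonal_map L dV hdV).symm (JW_eq (Fp L) L a),
      UnitaryGroup.placeForm_reindex_kronecker, hTJ, hW1]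
  -- the pairing of two lifts read at `w`
  have hform : ∀ z z' : Fin 2 → w.1.adicCompletion L,
      hermForm (conjLocal L (IsCMField.complexConj L) v) (gramS (Fp L) L v n' (gram (Fp L) e₁ (realDiagonal L dV hdV) (TW (Fp L) a)))
        (up z) (up z') w = aw * hermForm σ (formCongr σ T ((StdForm.antidiagonal 2).over (w.1.adicCompletion L))) z z' := by
    intro z z'
    rw [apply_hermForm_of_smul_eq (IsCMField.complexConj L) v w hc hw, hG, hupw, hupw, hermForm_reindex_kronecker_lift]
  -- the hyperbolic values of the frame and the scalar rules
  have h00 : hermForm σ (formCongr σ T ((StdForm.antidiagonal 2).over (w.1.adicCompletion L))) y₀ y₀ = 0 := by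
    rw [hy₀, hermForm_formCongr_frameVec, StdForm.antidiagonal_over_apply, if_neg (by decide)]
  have h01 : hermForm σ (formCongr σ T ((StdForm.antidiagonal 2).over (w.1.adicCompletion L))) y₀ y₁ = 1 := by
    rw [hy₀, hy₁, hermForm_formCongr_frameVec, StdForm.antidiagonal_over_apply, if_pos (by decide)]
  have h10 : hermForm σ (formCongr σ T ((StdForm.antidiagonal 2).over (w.1.adicCompletion L))) y₁ y₀ = 1 := by
    rw [hy₀, hy₁, hermForm_formCongr_frameVec, StdForm.antidiagonal_over_apply, if_pos (by decide)]
  have hsr : ∀ (H : Matrix (Fin 2) (Fin 2) (w.1.adicCompletion L)) (r : w.1.adicCompletion L) (x z : Fin 2 → w.1.adicCompletion L),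
      hermForm σ H x (r • z) = r * hermForm σ H x z := fun H r x z => by
    rw [hermForm_apply, hermForm_apply, Matrix.mulVec_smul, dotProduct_smul, smul_eq_mul]
  have hsl : ∀ (H : Matrix (Fin 2) (Fin 2) (w.1.adicCompletion L)) (r : w.1.adicCompletion L) (x z : Fin 2 → w.1.adicCompletion L),
      hermForm σ H (r • x) z = σ r * hermForm σ H x z := fun H r x z => by
    have h1 : (σ : _ → _) ∘ (r • x) = σ r • ((σ : _ → _) ∘ x) := funext fun k => by simp
    rw [hermForm_apply, hermForm_apply, h1, smul_dotProduct, smul_eq_mul]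
  -- integrality of the lifts: one place above `v`, `T⁻¹ ∈ GL₂(𝒪_w)`, `a` a unit at `w`
  have hupint : ∀ z : Fin 2 → w.1.adicCompletion L, (∀ k, Valued.v (z k) ≤ 1) → ∀ b : Fin n', IsIntegralLoc (Fp L) L v (up z b) := by
    intro z hz b w'
    obtain rfl : w' = w := PlacesOver.eq_of_smul_eq (IsCMField.complexConj L) hc w hw w'
    rw [hup, valuation_le_one_iff_valued]
    exact hz _
  have hTinv : ∀ i j, Valued.v (((T⁻¹ : GL (Fin 2) (w.1.adicCompletion L)) : Matrix (Fin 2) (Fin 2) (w.1.adicCompletion L)) i j) ≤ 1 :=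
    fun i j => (HeightOneSpectrum.mem_adicCompletionIntegers _ _ _).1 (((mem_glInt_adicCompletion_iff w.1 T).1 hTi).2 i j)
  have hy₀int : ∀ k, Valued.v (y₀ k) ≤ 1 := fun k => by
    rw [hy₀, Matrix.mulVec_single_one, Matrix.col_apply]; exact hTinv k 0
  have hysint : ∀ k, Valued.v ((aw⁻¹ • y₁) k) ≤ 1 := fun k => by
    rw [Pi.smul_apply, smul_eq_mul, map_mul, map_inv₀, haw, ha, inv_one, one_mul, hy₁, Matrix.mulVec_single_one, Matrix.col_apply]
    exact hTinv k 1
  refine ⟨Xp, X0, hX, hcp, hc0, up y₀, up (aw⁻¹ • y₁),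
    Pi.single (M := fun w' : UnitaryGroup.PlacesOver L v => w'.1.adicCompletion L) w ϖ,
    Pi.single (M := fun w' : UnitaryGroup.PlacesOver L v => w'.1.adicCompletion L) w ϖ⁻¹, ?_, ?_, ?_, ?_,
    hupint y₀ hy₀int, hupint _ hysint,
    Pi.single_eq_same (M := fun w' : UnitaryGroup.PlacesOver L v => w'.1.adicCompletion L) w ϖ,
    Pi.single_eq_same (M := fun w' : UnitaryGroup.PlacesOver L v => w'.1.adicCompletion L) w ϖ⁻¹, ?_, ?_, ?_⟩
  · -- `h(y,y) = 0`
    rw [LocalRing.eq_iff_apply_eq (IsCMField.complexConj L) hc w hw, hform, h00, mul_zero]; rfl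
  · -- `h(y*,y) = 1`
    rw [LocalRing.eq_iff_apply_eq (IsCMField.complexConj L) hc w hw, hform, hsl, h10, mul_one, map_inv₀, hσa, mul_inv_cancel₀ haw0]; rfl
  · -- `h(y,y*) = 1`
    rw [LocalRing.eq_iff_apply_eq (IsCMField.complexConj L) hc w hw, hform, hsr, h01, mul_one, mul_inv_cancel₀ haw0]; rfl
  · -- `y^⊥ = S·y`
    intro bb hbb
    -- the `w`-component of `bb` is the lift of `β i := bb_{e₁(i,0), w}`
    set β : Fin 2 → w.1.adicCompletion L := fun i => bb (e₁ (i, 0)) w with hβdef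
    have hb : ∀ b : Fin n', b = e₁ ((e₁.symm b).1, 0) := fun b => by
      conv_lhs => rw [← e₁.apply_symm_apply b]
      exact congrArg e₁ (Prod.ext rfl (Subsingleton.elim _ _))
    have hbβ : (fun b => bb b w) = fun b => β (e₁.symm b).1 := funext fun b => congrArg (fun k => bb k w) (hb b)
    have hw0 : hermForm (conjLocal L (IsCMField.complexConj L) v)
        (gramS (Fp L) L v n' (gram (Fp L) e₁ (realDiagonal L dV hdV) (TW (Fp L) a))) (up y₀) bb w = 0 := by rw [hbb]; rfl
    rw [apply_hermForm_of_smul_eq (IsCMField.complexConj L) v w hc hw, hG, hupw, hbβ, hermForm_reindex_kronecker_lift] at hw0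
    have hβ0 : hermForm σ (formCongr σ T ((StdForm.antidiagonal 2).over (w.1.adicCompletion L))) y₀ β = 0 :=
      (mul_eq_zero.1 hw0).resolve_left haw0
    rw [hy₀] at hβ0
    have hβ := eq_smul_frameVec_of_hermForm_eq_zero σ T β hβ0
    refine ⟨Pi.single (M := fun w' : UnitaryGroup.PlacesOver L v => w'.1.adicCompletion L) w
      (((T : Matrix (Fin 2) (Fin 2) (w.1.adicCompletion L)) *ᵥ β) 0), hveq _ _ fun b => ?_⟩
    rw [congrFun hbβ b]
    simp only [Pi.smul_apply, smul_eq_mul, Pi.mul_apply]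
    rw [Pi.single_eq_same, hup]
    conv_lhs => rw [hβ]
    rw [Pi.smul_apply, smul_eq_mul, hy₀]
  · -- `x ∈ X₊`: `(x ⊗ 1) y = α₊ y`
    intro x hx
    refine hveq _ _ fun b => ?_
    rw [apply_mulVec_localLineInl, hupw, reindex_kronecker_one_mulVec_lift]
    dsimp only
    rw [hXp x hx]
    simp only [Pi.smul_apply, smul_eq_mul, Pi.mul_apply]
    rw [Pi.single_eq_same, hup]
  · -- `x ∈ X₀`: `(x ⊗ 1) y = y`
    intro x hx
    rw [one_smul]
    refine hveq _ _ fun b => ?_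
    rw [apply_mulVec_localLineInl, hupw, reindex_kronecker_one_mulVec_lift]
    dsimp only
    rw [hX0 x hx, hup]
  · -- `t₁⁻¹`: `(t₁⁻¹ ⊗ 1) y = α₋ y`
    refine hveq _ _ fun b => ?_
    rw [apply_mulVec_localLineInl, hupw, reindex_kronecker_one_mulVec_lift]
    dsimp only
    rw [show ((t₁⁻¹ : UnitaryGroup.localPi L (IsCMField.complexConj L) 2 (Matrix.diagonal dV) v) : UnitaryGroup.LocalGLPi L 2 v) w =
        (t₁ : UnitaryGroup.LocalGLPi L 2 v)⁻¹ w from rfl, hti]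
    simp only [Pi.smul_apply, smul_eq_mul, Pi.mul_apply]
    rw [Pi.single_eq_same, hup]

end Inert

end Summit.HodgeConjecture.HodgeConjecture.Cruxes.HLiu418.K2LiuInertFrameInputsIntegral

end
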